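import Summits.CriticalPhenomena.PercolationContinuityZ3.Theorems.PercNearOneGluingNoHeavyQuantLawDecFlows
import HarnessLib

/-!
# QUANT lane R8, T-DEC: the TWO-ROW RATE LEMMAS behind the window / λ* form of slice closure — geometry of deep lows, band atoms and
# near light straddler mids; the anti-diagonal pair is compatible and cheaper; the band vertical pair is self-financing; row-0 rates only rise

builds on p205010 (kernel theorem, internal audit signed; external expert review pending)

Support file (`--supports stmt-CriticalPhenomena-4575`), QUANT lane lead seat prim-quant-lead (gen 22), rung R8 of
`run/shared/lean/prim/quant/LADDER.md`; memo `run/shared/lean/prim/quant/prim-quant-lead-g22/LEAD-NOTES-G22.md` N48.  Theorems only (real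
arithmetic on `LawDec.pairGate`), standard axioms, no sorries.  Continues `…QuantLawDecFlows` (typer g22: `pairGate`, `usage`, `FlowAtT`).

THE SETTING (slice of a law at target `T` by a blob `(a, g)`; new target `T′ = T + a·g`, layer `j′`; census-2 g54's refutation of two-layer SL and
its replacement, README V245 / lead g22 `…QuantSliceConeForm`).  A DEEP low `l` has `2(l+a) < T′` (its shifted copy is still low); a BAND atom `w`
has `T ≤ 2w < T′` (self-sufficient before the slice, low after it); a near light straddler is a mid `m ≤ j′` compatible with `l` at `T` (`T < l+m`)
whose shifted copy is a giant (`m + a > j′`).  The lemmas: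
* `deep_straddler_two_mul_gt` — GEOMETRY: `2(l+a) < T′`, `T < l + m`, `g ≤ 1` ⟹ `T′ < 2m` (a straddler mid of a deep low is a true mid of the slice,
  hence above every band atom: `band_lt_straddler`); `band_deep_incompatible` — a band atom is never compatible with a deep low (`l + w < T`).
  Consequence (N48): the layer `λ* = (least true window mid) − 1` sees every straddler mid as a giant and no band atom as a giant.
* `pairGate_mono_rho` — the minimal gate is monotone in `ρ`; `pairGate_raise_target` — raising the target raises the row-0 gate.
* **`antiDiag_compatible`, `antiDiag_rho_le`, `pairGate_antiDiag_le`** — the ANTI-DIAGONAL pair `(l+a, m)` at `T′` is compatible whenever `(l, m)` is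
  compatible at `T`, and its minimal gate is at most that of `(l, m)` at `T` (census-2 g54 SL-STRUCTURE-G54 §2's mechanism, exact).
* **`pairGate_vertical_le`** — the BAND VERTICAL pair `(w, w+a)` at `T′` has minimal gate `≤ g` (`T ≤ 2w`, `0 ≤ x ≤ g`); with `gate_div_le`
  (`γ ≤ g < 1 ⟹ (1−g)·γ/(1−γ) ≤ g`) a band atom's row-0 copy is absorbed by its own row-1 copy: band atoms are self-financing.
These are the ingredients of the single-low blueprint (N48 (3): explicit routing R*, 119 026 exact instances / 0; Case 1 proved by the
`g`-mixture of the layer-`λ*` and layer-`j′` capacity inequalities plus `pairGate_antiDiag_le`).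

[this work]; DEC rules ARCH-TREES-G49 §2.2 / DEC-TAMP-G50 §3.1, SL-STRUCTURE-G54 §2 (this lane).  The gluing rows served
[cite: KozmaNitzan2024, Conjecture 3 (p. 15)]; product measure [cite: Grimmett1999, §1.3 p. 10].
-/

noncomputable section

namespace Summit.CriticalPhenomena.PercolationContinuityZ3.Theorems

namespace Quant

namespace LawDec

/-! ### Geometry of deep lows, band atoms, straddler mids -/

/-- **a straddler mid of a deep low is a true mid of the slice**: `2(l+a) < T + a·g`, `T < l + m`, `g ≤ 1` ⟹ `T + a·g < 2m`. [this work] -/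
theorem deep_straddler_two_mul_gt (T g : ℝ) (l m a : ℕ) (hg1 : g ≤ 1) (hdeep : 2 * ((l : ℝ) + a) < T + (a : ℝ) * g)
    (hcomp : T < (l : ℝ) + m) : T + (a : ℝ) * g < 2 * (m : ℝ) := by
  have ha : (0 : ℝ) ≤ a := Nat.cast_nonneg a
  nlinarith

/-- **band atoms lie below straddler mids**: `2w < T + a·g` and the hypotheses of `deep_straddler_two_mul_gt` ⟹ `w < m`. [this work] -/
theorem band_lt_straddler (T g : ℝ) (l m w a : ℕ) (hg1 : g ≤ 1) (hdeep : 2 * ((l : ℝ) + a) < T + (a : ℝ) * g)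
    (hcomp : T < (l : ℝ) + m) (hband : 2 * (w : ℝ) < T + (a : ℝ) * g) : w < m := by
  have h := deep_straddler_two_mul_gt T g l m a hg1 hdeep hcomp
  have : (w : ℝ) < m := by linarith
  exact_mod_cast this

/-- **a band atom is never compatible with a deep low**: `2w < T + a·g`, `2(l+a) < T + a·g`, `g ≤ 1` ⟹ `l + w < T` (so `¬ T < l + w`). [this work] -/
theorem band_deep_incompatible (T g : ℝ) (l w a : ℕ) (hg1 : g ≤ 1) (hdeep : 2 * ((l : ℝ) + a) < T + (a : ℝ) * g)
    (hband : 2 * (w : ℝ) < T + (a : ℝ) * g) : (l : ℝ) + w < T := by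
  have ha : (0 : ℝ) ≤ a := Nat.cast_nonneg a
  nlinarith

/-! ### The minimal gate is monotone in `ρ` -/

/-- `max(ρ, x² + (1−x)ρ)` is monotone in `ρ` for `x ≤ 1`. [this work] -/
theorem gateFun_mono {x ρ₁ ρ₂ : ℝ} (hx1 : x ≤ 1) (h : ρ₁ ≤ ρ₂) :
    max ρ₁ (x ^ 2 + (1 - x) * ρ₁) ≤ max ρ₂ (x ^ 2 + (1 - x) * ρ₂) := by
  refine max_le_max h ?_
  have : 0 ≤ 1 - x := by linarith
  nlinarith

/-- **`pairGate` is monotone in `ρ = (T − 2l)/(h − l)`**: if the `ρ` of `(l₁, h₁)` at `T₁` is at most the `ρ` of `(l₂, h₂)` at `T₂` then so are the gates. [this work] -/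
theorem pairGate_mono_rho (x T₁ T₂ : ℝ) (l₁ h₁ l₂ h₂ : ℕ) (hx1 : x ≤ 1)
    (h : (T₁ - 2 * (l₁ : ℝ)) / ((h₁ : ℝ) - l₁) ≤ (T₂ - 2 * (l₂ : ℝ)) / ((h₂ : ℝ) - l₂)) :
    pairGate x T₁ l₁ h₁ ≤ pairGate x T₂ l₂ h₂ := by
  unfold pairGate
  exact gateFun_mono hx1 h

/-- **raising the target raises the row-0 gate**: `T ≤ T′`, `l < h` ⟹ `pairGate x T l h ≤ pairGate x T′ l h`. [this work] -/
theorem pairGate_raise_target (x T T' : ℝ) (l h : ℕ) (hx1 : x ≤ 1) (hlt : l < h) (hTT : T ≤ T') :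
    pairGate x T l h ≤ pairGate x T' l h := by
  refine pairGate_mono_rho x T T' l h l h hx1 ?_
  have hd : (0 : ℝ) < (h : ℝ) - l := by
    have : (l : ℝ) < h := by exact_mod_cast hlt
    linarith
  exact div_le_div_of_nonneg_right (by linarith) hd.le

/-! ### The anti-diagonal pair `(l + a, m)` -/

/-- **the anti-diagonal pair is compatible**: `T < l + m` and `g ≤ 1` ⟹ `T + a·g < (l + a) + m`. [this work] -/
theorem antiDiag_compatible (T g : ℝ) (l m a : ℕ) (hg1 : g ≤ 1) (hcomp : T < (l : ℝ) + m) :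
    T + (a : ℝ) * g < ((l + a : ℕ) : ℝ) + m := by
  have ha : (0 : ℝ) ≤ a := Nat.cast_nonneg a
  push_cast
  nlinarith

/-- **the anti-diagonal `ρ` is at most the original `ρ`** (SL-STRUCTURE-G54 §2): for `l < m`, `T < l + m` (compatible), `g ≤ 1` and
`l + a < m`:  `(T + a·g − 2(l+a))/(m − (l+a)) ≤ (T − 2l)/(m − l)`.  Proof: cross-multiplied it reads `T − 2l ≤ (2 − g)(m − l)`, which follows
from `T − 2l < m − l` and `2 − g ≥ 1`. [this work] -/
theorem antiDiag_rho_le (T g : ℝ) (l m a : ℕ) (hg1 : g ≤ 1) (hcomp : T < (l : ℝ) + m) (hlam : l + a < m) :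
    (T + (a : ℝ) * g - 2 * (((l + a : ℕ) : ℝ))) / ((m : ℝ) - ((l + a : ℕ) : ℝ)) ≤ (T - 2 * (l : ℝ)) / ((m : ℝ) - l) := by
  have ha : (0 : ℝ) ≤ a := Nat.cast_nonneg a
  have hd1 : (0 : ℝ) < (m : ℝ) - ((l + a : ℕ) : ℝ) := by
    have : ((l + a : ℕ) : ℝ) < m := by exact_mod_cast hlam
    linarith
  have hd2 : (0 : ℝ) < (m : ℝ) - l := by
    have : ((l + a : ℕ) : ℝ) < m := by exact_mod_cast hlam
    push_cast at this
    linarith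
  rw [div_le_div_iff₀ hd1 hd2]
  push_cast
  -- (T + ag − 2l − 2a)(m − l) ≤ (T − 2l)(m − l − a)  ⟺  a·(T − 2l) ≤ a·(2 − g)(m − l)
  have key : (T - 2 * (l : ℝ)) ≤ (2 - g) * ((m : ℝ) - l) := by nlinarith
  nlinarith [mul_le_mul_of_nonneg_left key ha]

/-- **the anti-diagonal pair is cheaper**: under the hypotheses of `antiDiag_rho_le` and `x ≤ 1`,
`pairGate x (T + a·g) (l+a) m ≤ pairGate x T l m`. [this work] -/
theorem pairGate_antiDiag_le (x T g : ℝ) (l m a : ℕ) (hx1 : x ≤ 1) (hg1 : g ≤ 1) (hcomp : T < (l : ℝ) + m) (hlam : l + a < m) :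
    pairGate x (T + (a : ℝ) * g) (l + a) m ≤ pairGate x T l m :=
  pairGate_mono_rho x _ _ (l + a) m l m hx1 (antiDiag_rho_le T g l m a hg1 hcomp hlam)

/-- for a deep low the anti-diagonal pair exists: `2(l+a) < T + a·g ≤ …`; with `T + a·g < 2m` (a true mid of the slice) we get `l + a < m`. [this work] -/
theorem deep_lt_mid (T g : ℝ) (l m a : ℕ) (hdeep : 2 * ((l : ℝ) + a) < T + (a : ℝ) * g) (hmid : T + (a : ℝ) * g ≤ 2 * (m : ℝ)) :
    l + a < m := by
  have : ((l : ℝ) + a) < m := by linarith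
  exact_mod_cast this

/-! ### The band vertical pair `(w, w + a)` -/

/-- **the band vertical pair has gate at most `g`**: `T ≤ 2w`, `0 ≤ x ≤ g ≤ 1`, `1 ≤ a` ⟹ `pairGate x (T + a·g) w (w + a) ≤ g`
(`ρ_v = (T + ag − 2w)/a ≤ g`, and `x² + (1−x)ρ_v ≤ x² + (1−x)g ≤ g`). [this work] -/
theorem pairGate_vertical_le (x T g : ℝ) (w a : ℕ) (hx0 : 0 ≤ x) (hxg : x ≤ g) (hg1 : g ≤ 1) (ha : 1 ≤ a)
    (hband : T ≤ 2 * (w : ℝ)) :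
    pairGate x (T + (a : ℝ) * g) w (w + a) ≤ g := by
  unfold pairGate
  have ha' : (0 : ℝ) < a := by exact_mod_cast (lt_of_lt_of_le Nat.zero_lt_one ha)
  have hden : ((w + a : ℕ) : ℝ) - w = a := by push_cast; ring
  rw [hden]
  have hρ : (T + (a : ℝ) * g - 2 * (w : ℝ)) / (a : ℝ) ≤ g := by
    rw [div_le_iff₀ ha']
    linarith
  refine max_le hρ ?_
  have h1x : 0 ≤ 1 - x := by linarith
  nlinarith [mul_le_mul_of_nonneg_left hρ h1x, mul_nonneg hx0 (sub_nonneg.2 hxg)]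

/-- **gate `≤ g < 1` ⟹ the row-0 copy is paid by the row-1 copy**: `(1 − g)·γ/(1 − γ) ≤ g` for `γ ≤ g < 1`. [this work] -/
theorem gate_div_le (γ g : ℝ) (hγg : γ ≤ g) (hg1 : g < 1) : (1 - g) * (γ / (1 - γ)) ≤ g := by
  have h1 : 0 < 1 - γ := by linarith
  rw [mul_div_assoc', div_le_iff₀ h1]
  nlinarith

/-- **band atoms are self-financing**: for a band atom (`T ≤ 2w`), `0 ≤ x ≤ g < 1`, `1 ≤ a`: one unit of row-0 mass at `w`, shipped through the
vertical pair at its minimal gate, consumes at most `g/(1−g)` units — i.e. `(1 − g)·usage ≤ g`, exactly the mass ratio of the two copies. [this work] -/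
theorem band_vertical_selfFinancing (x T g : ℝ) (w a : ℕ) (hx0 : 0 ≤ x) (hxg : x ≤ g) (hg1 : g < 1) (ha : 1 ≤ a)
    (hband : T ≤ 2 * (w : ℝ)) :
    (1 - g) * (pairGate x (T + (a : ℝ) * g) w (w + a) / (1 - pairGate x (T + (a : ℝ) * g) w (w + a))) ≤ g :=
  gate_div_le _ g (pairGate_vertical_le x T g w a hx0 hxg hg1.le ha hband) hg1

end LawDec

end Quant

end Summit.CriticalPhenomena.PercolationContinuityZ3.Theorems
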